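import Summits.BirchSwinnertonDyer.BirchSwinnertonDyer.Theses.ShaPrimaryTransfer
import Literature.NumberTheory.EllipticCurves.KubertTate16883GaussianDescent
import HarnessLib

/-!
# BirchSwinnertonDyer / ShaPrimaryTransfer — crux `FiniteShaComponentTransfer` (stmt-BirchSwinnertonDyer-22356):
# THE FIRST UNCONDITIONAL DOOR AT 5 ON A CURVE WITHOUT RATIONAL 5-TORSION — the twist `E_{168/83}^{(-4)}`

Helper file of prover seat `bsd-line-spt-p1` g20 (`--supports stmt-22356 --as helper`). THEOREMS ONLY. The tree's
`Literature/…/KubertTate16883GaussianDescent` runs the complete `5`-isogeny descent of `E_{168/83} = [-85,-13944,-1157352,0,0]`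
over `ℚ(i)` (rank `3`, `Ш[5] = 0`) and descends to the quadratic twist `E_{168/83}^{(-4)}/ℚ` (`≅ E^{(-1)}`; NO rational
`5`-torsion point): `rank E^{(-4)}(ℚ) = 0` and `t₅(E^{(-4)}) = corank_{ℤ₅} Ш(E^{(-4)}/ℚ)[5^∞] = 0`, with no `L`-function,
`p`-adic or conjectural input.  Here this is read in the route's currency (`K = CyclotomicField 4 ℚ` as the auxiliary field):

* `shaCorank_five_twist_eq_zero` — `t₅(E_{168/83}^{(-4)}) = 0`; `mordellWeilRank_twist_eq_zero` — rank `0`;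
* `oneFiniteShaComponent_twist` — O (`OneFiniteShaComponent`'s shape) for the twist with witness `p₀ = 5`;
* `transfer_twist` — **T BY NAME** on the twist: `FiniteShaComponentTransfer → ∀ q, t_q(E_{168/83}^{(-4)}) = 0`.

For a rank-`0` curve, `Ш[5^∞]` finite is otherwise Kolyvagin's theorem (needs `L(E,1) ≠ 0`); here it is descent alone.
T is UNCHANGED (conjecture-grade at analytic rank ≥ 2) and BSD is NOT proved by any of this.

## References

* [SilvermanAEC2009] J. H. Silverman, *AEC*, 2nd ed., Thm. X.4.2, Exercise 10.16.
* [Fisher2001FiveSevenDescent] T. Fisher, JEMS 3 (2001), §§1–2.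
-/

-- D-0017: single-problem summit, so `Summit.BirchSwinnertonDyer.BirchSwinnertonDyer.…` repeats a namespace BY DESIGN.
set_option linter.dupNamespace false
set_option autoImplicit false

noncomputable section

open scoped Classical
open Literature.NumberTheory.EllipticCurves WeierstrassCurve
open Summit.BirchSwinnertonDyer.BirchSwinnertonDyer.Theses.ShaPrimaryTransfer

namespace Summit.BirchSwinnertonDyer.BirchSwinnertonDyer.Theorems.ShaPrimaryTransferGaussianTwistDoor16883

/-- The twist `E_{168/83}^{(-4)}` is elliptic (`-4 ≠ 0`). [cite: SilvermanAEC2009, X.§2] -/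
theorem isElliptic_twist :
    haveI := KubertTate16883Descent.isElliptic
    ((kubertTateFive (((168 : ℤ) : ℚ)) (((83 : ℤ) : ℚ))).quadraticTwist (-4)).IsElliptic := by
  haveI := KubertTate16883Descent.isElliptic
  exact isElliptic_quadraticTwist _ (by norm_num)

/-- **`t₅(E_{168/83}^{(-4)}/ℚ) = 0`, unconditionally** (descent over `ℚ(i) = CyclotomicField 4 ℚ`; tree
`KubertTate16883GaussianDescent.shaCorank_five_twist_eq_zero`). [cite: SilvermanAEC2009, Thm. X.4.2 and Exercise 10.16]
[cite: Fisher2001FiveSevenDescent, §2] -/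
theorem shaCorank_five_twist_eq_zero :
    haveI := KubertTate16883Descent.isElliptic
    haveI := isElliptic_twist
    ((kubertTateFive (((168 : ℤ) : ℚ)) (((83 : ℤ) : ℚ))).quadraticTwist (-4)).shaCorank 5 = 0 := by
  haveI := KubertTate16883Descent.isElliptic
  haveI := isElliptic_twist
  haveI : IsCyclotomicExtension {4} ℚ (CyclotomicField 4 ℚ) := CyclotomicField.isCyclotomicExtension 4 ℚ
  exact KubertTate16883GaussianDescent.shaCorank_five_twist_eq_zero (CyclotomicField 4 ℚ)

/-- **`rank E_{168/83}^{(-4)}(ℚ) = 0`, unconditionally.** [cite: SilvermanAEC2009, Exercise 10.16] -/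
theorem mordellWeilRank_twist_eq_zero :
    haveI := KubertTate16883Descent.isElliptic
    haveI := isElliptic_twist
    ((kubertTateFive (((168 : ℤ) : ℚ)) (((83 : ℤ) : ℚ))).quadraticTwist (-4)).mordellWeilRank = 0 := by
  haveI := KubertTate16883Descent.isElliptic
  haveI := isElliptic_twist
  haveI : IsCyclotomicExtension {4} ℚ (CyclotomicField 4 ℚ) := CyclotomicField.isCyclotomicExtension 4 ℚ
  exact KubertTate16883GaussianDescent.mordellWeilRank_twist_eq_zero (CyclotomicField 4 ℚ)

/-- **O for `E_{168/83}^{(-4)}` with witness `p₀ = 5`** (the route's `OneFiniteShaComponent` shape, unconditional, on a curve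
without rational `5`-torsion). [cite: SilvermanAEC2009, Thm. X.4.2] -/
theorem oneFiniteShaComponent_twist :
    haveI := KubertTate16883Descent.isElliptic
    haveI := isElliptic_twist
    ∃ (p : ℕ) (_ : Fact p.Prime), ((kubertTateFive (((168 : ℤ) : ℚ)) (((83 : ℤ) : ℚ))).quadraticTwist (-4)).shaCorank p = 0 :=
  ⟨5, ⟨Nat.prime_five⟩, shaCorank_five_twist_eq_zero⟩

/-- **T BY NAME on `E_{168/83}^{(-4)}`**: granting `FiniteShaComponentTransfer`, every primary component of
`Ш(E_{168/83}^{(-4)}/ℚ)` has corank `0` — an instance of T's load-bearing slice (admissible door `5` on a curve with no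
rational `5`-torsion) fed by an unconditional door. T itself is NOT proved. [cite: SilvermanAEC2009, Thm. X.4.2] -/
theorem transfer_twist (hT : FiniteShaComponentTransfer) (q : ℕ) [Fact q.Prime] :
    haveI := KubertTate16883Descent.isElliptic
    haveI := isElliptic_twist
    ((kubertTateFive (((168 : ℤ) : ℚ)) (((83 : ℤ) : ℚ))).quadraticTwist (-4)).shaCorank q = 0 := by
  haveI := KubertTate16883Descent.isElliptic
  haveI := isElliptic_twist
  haveI : Fact (Nat.Prime 5) := ⟨Nat.prime_five⟩
  exact hT _ 5 q shaCorank_five_twist_eq_zero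

end Summit.BirchSwinnertonDyer.BirchSwinnertonDyer.Theorems.ShaPrimaryTransferGaussianTwistDoor16883

end
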